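import Literature.MathematicalPhysics.QuantumLattice.TwistedSectorClassicalRate
import Mathlib.RingTheory.RootsOfUnity.Complex
import Mathlib.LinearAlgebra.Eigenspace.Triangularizable
import Mathlib.LinearAlgebra.Eigenspace.Charpoly
import HarnessLib

/-!
# Twist eaters exist iff the twist is orthogonal (`SU(N)`, `d = 4`): proofs

Sibling proof file of `Literature/MathematicalPhysics/QuantumLattice/TwistedSectorClassicalRate.lean` (same
namespace `Literature.MathematicalPhysics.QuantumLattice.TwistedSector`). It DISCHARGES the named fact
`EaterIffOrthogonal` (González-Arroyo 1998, *Yang–Mills fields on the 4-dimensional torus I*, §4.2 p. 7: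
«the necessary and sufficient condition for the existence of solutions is that gcd(κ(n), N) = N»; after
't Hooft 1981, van Baal 1983, van Baal–van Geemen 1986, Lebedev–Polikarpov 1986) as
`EaterIffOrthogonal_holds : ∀ N ≥ 1, EaterIffOrthogonal N`, following the printed route of op. cit. §4.2:

* **Tables.** The eater relation is extended to all ordered pairs, `Γ_μ Γ_ν = e^{2πi A_{μν}/N} Γ_ν Γ_μ` for an
  alternating `4 × 4` table `A` over `ℤ/N` (`EaterRel`, `isTwistEater_iff_eaterRel`); `Pf(A) = κ(n)`.
* **Generator changes** (`Γ_μ ↦ Γ(s^{(μ)})`, «n ↦ s n sᵀ», op. cit. (4.2)): index permutations and the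
  transvections `Γ_i ↦ Γ_i Γ_j^c` transport eaters (`EaterRel.transvec`: central commutators are
  bimultiplicative) and preserve `Pf = 0` (`pf_transvec`, `det T = 1`).
* **Canonical form** (op. cit.: «bring n_{μν} to a canonical form»): Euclid's algorithm on representatives in
  `ℤ/N` clears the cross entries, `A ↦ (A₀₁, A₂₃)` (`canonReach`, strong induction on
  `5·A₀₁.val + #{cross entries ≠ 0}`).
* **Existence** for `N ∣ A₀₁·A₂₃` (op. cit.: «solutions exist iff p₁ p₂ divides N … direct sums of the
  irreducible one»): clock-and-shift pairs on `ℤ/p₁ × ℤ/p₂ × Fin (N/p₁p₂)`, reindexed to `Fin N` and rescaled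
  into `SU(N)` (`exists_eaterRel_of_canon`).
* **Necessity**: `Γ₂, Γ₃` preserve the generalized eigenspaces `E_λ` of `Γ₀`, where `det` gives
  `ω^{b·dim E_λ} = 1`; `Γ₁ : E_λ ↪ E_{ω^a λ}` makes `dim E_λ` constant on `ω^a`-orbits of size `p₁ = N/gcd(a,N)`
  (`orbit_sum`), so `N = p₁·M`, `N ∣ b·M`, `N ∣ a·b` (`mul_eq_zero_of_eaterRel_canon`) — the elementary
  substitute for the irreducibility/Schur count `N₀ = p₁ p₂ ∣ N` of the printed proof.

Scope: exactly the tree's statement (`d = 4`, `SU(N)`, `N ≥ 1`); nothing on uniqueness/irreducibility of the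
eaters (op. cit. §4.2 second and third bullet) and nothing for `d ≠ 4`.
-/

noncomputable section

open Literature.MathematicalPhysics.QuantumLattice

namespace Literature.MathematicalPhysics.QuantumLattice

namespace TwistedSector

section Phase

variable (N : ℕ)

/-- `ω_N = exp(2πi/N)`. [folklore] -/
def rootω : ℂ := Complex.exp (2 * Real.pi * Complex.I / N)

/-- `ω_N` is a primitive `N`-th root of unity. [folklore] -/
private theorem rootω_isPrimitiveRoot [NeZero N] : IsPrimitiveRoot (rootω N) N :=
  Complex.isPrimitiveRoot_exp N (NeZero.ne N)

/-- `ω^k = ω^(k mod N)`. [folklore] -/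
private theorem rootω_pow_mod [NeZero N] (s : ℕ) : rootω N ^ (s % N) = rootω N ^ s := by
  have h := pow_mod_orderOf (rootω N) s
  rwa [← (rootω_isPrimitiveRoot N).eq_orderOf] at h

/-- The centre phase is a power of `ω_N`: `e^{2πi k/N} = ω^{k.val}`. [folklore] -/
private theorem centerPhase_eq_pow (k : ZMod N) : centerPhase N k = rootω N ^ k.val := by
  rw [centerPhase, rootω, ← Complex.exp_nat_mul]
  congr 1
  push_cast
  ring

/-- `e^{2πi·0/N} = 1`. [folklore] -/
private theorem centerPhase_zero : centerPhase N 0 = 1 := by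
  rw [centerPhase_eq_pow, ZMod.val_zero, pow_zero]

/-- Additivity: `φ(x + y) = φ(x) φ(y)`. [folklore] -/
private theorem centerPhase_add [NeZero N] (x y : ZMod N) : centerPhase N (x + y) = centerPhase N x * centerPhase N y := by
  rw [centerPhase_eq_pow, centerPhase_eq_pow, centerPhase_eq_pow, ← pow_add, ZMod.val_add, rootω_pow_mod]

/-- `φ(c x) = φ(x)^{c.val}`. [folklore] -/
private theorem centerPhase_mul [NeZero N] (c x : ZMod N) : centerPhase N (c * x) = centerPhase N x ^ c.val := by
  rw [centerPhase_eq_pow, centerPhase_eq_pow, ← pow_mul, ZMod.val_mul, rootω_pow_mod, mul_comm]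

/-- `φ(x) ≠ 0`. [folklore] -/
private theorem centerPhase_ne_zero (x : ZMod N) : centerPhase N x ≠ 0 := by
  intro h
  have := norm_centerPhase N x
  rw [h, norm_zero] at this
  exact zero_ne_one this

/-- `φ(−x) = φ(x)⁻¹`. [folklore] -/
private theorem centerPhase_neg [NeZero N] (x : ZMod N) : centerPhase N (-x) = (centerPhase N x)⁻¹ := by
  have h : centerPhase N (-x) * centerPhase N x = 1 := by
    rw [← centerPhase_add, neg_add_cancel, centerPhase_zero]
  exact eq_inv_of_mul_eq_one_left h

/-- `φ(x)^m = 1 ↔ N ∣ x.val·m`. [folklore] -/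
private theorem centerPhase_pow_eq_one_iff [NeZero N] (x : ZMod N) (m : ℕ) : centerPhase N x ^ m = 1 ↔ N ∣ x.val * m := by
  rw [centerPhase_eq_pow, ← pow_mul, (rootω_isPrimitiveRoot N).pow_eq_one_iff_dvd]

/-- `φ(x) = 1 ↔ x = 0`. [folklore] -/
private theorem centerPhase_eq_one_iff [NeZero N] (x : ZMod N) : centerPhase N x = 1 ↔ x = 0 := by
  have h := centerPhase_pow_eq_one_iff N x 1
  rw [pow_one, mul_one] at h
  rw [h]
  constructor
  · intro hd
    have : x.val = 0 := Nat.eq_zero_of_dvd_of_lt hd (ZMod.val_lt x)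
    exact (ZMod.val_eq_zero x).1 this
  · rintro rfl
    rw [ZMod.val_zero]
    exact dvd_zero N

end Phase

/-! ### Relation tables: eaters of an alternating matrix over `ℤ/N` -/

section Table

variable {N : ℕ}

/-- Local shorthand for `SU(N)` as a type. [folklore] -/
abbrev SUN (N : ℕ) : Type := Matrix.specialUnitaryGroup (Fin N) ℂ

/-- The full (all ordered pairs) eater relation for a `4 × 4` table `A` over `ℤ/N`:
`Γ_μ Γ_ν = e^{2πi A_{μν}/N} Γ_ν Γ_μ` for ALL `μ, ν` (matrix level; the twist-eater relation (twisteat) of op. cit.).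
[cite: Gonzalezarroyo1998, §4.2] -/
def EaterRel (A : Matrix (Fin 4) (Fin 4) (ZMod N)) (Γ : Fin 4 → SUN N) : Prop :=
  ∀ μ ν : Fin 4, (Γ μ : Matrix (Fin N) (Fin N) ℂ) * Γ ν = centerPhase N (A μ ν) • ((Γ ν : Matrix (Fin N) (Fin N) ℂ) * Γ μ)

/-- Alternating `4 × 4` matrices: zero diagonal and antisymmetric (the twist tensors `n_{μν}`).
[cite: Gonzalezarroyo1998, §4.2] -/
def IsAlt {R : Type*} [CommRing R] (A : Matrix (Fin 4) (Fin 4) R) : Prop :=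
  (∀ i, A i i = 0) ∧ ∀ i j, A j i = -A i j

/-- The Pfaffian of a `4 × 4` alternating matrix (in terms of its upper entries): `κ(n) = Pf(n)`.
[cite: Gonzalezarroyo1998, §4.2] -/
def pf {R : Type*} [CommRing R] (A : Matrix (Fin 4) (Fin 4) R) : R :=
  A 0 1 * A 2 3 - A 0 2 * A 1 3 + A 0 3 * A 1 2

/-- The alternating matrix of a twist tensor (`μ < ν` entries are the tensor's). [cite: Gonzalezarroyo1998, §4.2] -/
def altOfTensor (n : Plane 4 → ZMod N) : Matrix (Fin 4) (Fin 4) (ZMod N) :=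
  fun μ ν => if h : μ < ν then n ⟨(μ, ν), h⟩ else if h' : ν < μ then -n ⟨(ν, μ), h'⟩ else 0

/-- Upper entries of `altOfTensor`. [folklore] -/
private theorem altOfTensor_of_lt (n : Plane 4 → ZMod N) {μ ν : Fin 4} (h : μ < ν) :
    altOfTensor n μ ν = n ⟨(μ, ν), h⟩ := by
  simp [altOfTensor, h]

/-- `altOfTensor n` is alternating. [folklore] -/
private theorem isAlt_altOfTensor (n : Plane 4 → ZMod N) : IsAlt (altOfTensor n) := by
  refine ⟨fun i => by simp [altOfTensor], fun i j => ?_⟩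
  rcases lt_trichotomy i j with h | rfl | h
  · simp [altOfTensor, h, not_lt.2 h.le]
  · simp [altOfTensor]
  · simp [altOfTensor, h, not_lt.2 h.le]

/-- `Pf(altOfTensor n) = κ(n)`. [cite: Gonzalezarroyo1998, §4.2] -/
theorem pf_altOfTensor (n : Plane 4 → ZMod N) : pf (altOfTensor n) = twistKappa n := by
  simp only [pf, twistKappa]
  rw [altOfTensor_of_lt n (by decide : (0 : Fin 4) < 1), altOfTensor_of_lt n (by decide : (2 : Fin 4) < 3),
    altOfTensor_of_lt n (by decide : (0 : Fin 4) < 2), altOfTensor_of_lt n (by decide : (1 : Fin 4) < 3),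
    altOfTensor_of_lt n (by decide : (0 : Fin 4) < 3), altOfTensor_of_lt n (by decide : (1 : Fin 4) < 2)]

/-- A matrix in `SU(N)` (`N ≥ 1`) is not the zero matrix. [folklore] -/
private theorem coe_ne_zero [NeZero N] (g : SUN N) : (g : Matrix (Fin N) (Fin N) ℂ) ≠ 0 := by
  intro h
  have hdet := (Matrix.mem_specialUnitaryGroup_iff.1 g.2).2
  rw [h] at hdet
  haveI : Nonempty (Fin N) := ⟨⟨0, Nat.pos_of_ne_zero (NeZero.ne N)⟩⟩
  rw [Matrix.det_zero] at hdet
  · exact zero_ne_one hdet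

/-- If `c • M = M` for a nonzero matrix then `c = 1`. [folklore] -/
private theorem eq_one_of_smul_eq_self {M : Matrix (Fin N) (Fin N) ℂ} (hM : M ≠ 0) {c : ℂ} (h : c • M = M) : c = 1 := by
  have h' : (c - 1) • M = 0 := by rw [sub_smul, one_smul, h, sub_self]
  rcases smul_eq_zero.1 h' with h1 | h1
  · exact sub_eq_zero.1 h1
  · exact absurd h1 hM

/-- An eater table is automatically alternating. [folklore] -/
private theorem EaterRel.isAlt [NeZero N] {A : Matrix (Fin 4) (Fin 4) (ZMod N)} {Γ : Fin 4 → SUN N} (h : EaterRel A Γ) :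
    IsAlt A := by
  have hprod : ∀ μ ν : Fin 4, ((Γ μ : Matrix (Fin N) (Fin N) ℂ) * Γ ν) ≠ 0 := fun μ ν => by
    have := coe_ne_zero (Γ μ * Γ ν)
    simpa using this
  constructor
  · intro i
    have hi := h i i
    have := eq_one_of_smul_eq_self (hprod i i) hi.symm
    exact (centerPhase_eq_one_iff N _).1 this
  · intro i j
    have hij := h i j
    have hji := h j i
    rw [hij, smul_smul] at hji
    have := eq_one_of_smul_eq_self (hprod j i) hji.symm
    rw [← centerPhase_add, centerPhase_eq_one_iff] at this
    exact eq_neg_of_add_eq_zero_left this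

/-- The eater relation for `μ < ν` (with an alternating table) gives the full table. [folklore] -/
private theorem eaterRel_of_lt [NeZero N] {A : Matrix (Fin 4) (Fin 4) (ZMod N)} (hA : IsAlt A) {Γ : Fin 4 → SUN N}
    (h : ∀ μ ν : Fin 4, μ < ν →
      (Γ μ : Matrix (Fin N) (Fin N) ℂ) * Γ ν = centerPhase N (A μ ν) • ((Γ ν : Matrix (Fin N) (Fin N) ℂ) * Γ μ)) :
    EaterRel A Γ := by
  intro μ ν
  rcases lt_trichotomy μ ν with hlt | rfl | hgt
  · exact h μ ν hlt
  · rw [hA.1 μ, centerPhase_zero, one_smul]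
  · have := h ν μ hgt
    rw [hA.2 ν μ, centerPhase_neg, this, smul_smul, inv_mul_cancel₀ (centerPhase_ne_zero N _), one_smul]

/-- Link with the tree's `IsTwistEater` for `twistOfTensor` (the relation (twisteat) of op. cit.).
[cite: Gonzalezarroyo1998, §4.2] -/
theorem isTwistEater_iff_eaterRel [NeZero N] (n : Plane 4 → ZMod N) (Γ : Fin 4 → SUN N) :
    IsTwistEater (twistOfTensor N n) Γ ↔ EaterRel (altOfTensor n) Γ := by
  constructor
  · intro h
    refine eaterRel_of_lt (isAlt_altOfTensor n) fun μ ν hμν => ?_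
    have := congrArg (fun g : SUN N => (g : Matrix (Fin N) (Fin N) ℂ)) (h μ ν hμν)
    simpa [twistOfTensor, Matrix.smul_mul, altOfTensor_of_lt n hμν] using this
  · intro h μ ν hμν
    apply Subtype.ext
    have := h μ ν
    rw [altOfTensor_of_lt n hμν] at this
    simpa [twistOfTensor, Matrix.smul_mul] using this


/-! ### Moves on tables: index permutations and transvections `Γ_i ↦ Γ_i Γ_j^c` -/

/-- `X Y = φ Y X` ⟹ `X Yᵏ = φᵏ Yᵏ X`. [folklore] -/
private theorem mul_pow_of_rel {X Y : Matrix (Fin N) (Fin N) ℂ} {φ : ℂ} (h : X * Y = φ • (Y * X)) :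
    ∀ k : ℕ, X * Y ^ k = φ ^ k • (Y ^ k * X)
  | 0 => by simp
  | k + 1 => by
    rw [pow_succ, ← mul_assoc, mul_pow_of_rel h k, Matrix.smul_mul, mul_assoc, h, Matrix.mul_smul, smul_smul,
      ← mul_assoc, pow_succ]

/-- `X Y = φ Y X` ⟹ `Xᵏ Y = φᵏ Y Xᵏ`. [folklore] -/
private theorem pow_mul_of_rel {X Y : Matrix (Fin N) (Fin N) ℂ} {φ : ℂ} (h : X * Y = φ • (Y * X)) :
    ∀ k : ℕ, X ^ k * Y = φ ^ k • (Y * X ^ k)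
  | 0 => by simp
  | k + 1 => by
    rw [pow_succ', mul_assoc, pow_mul_of_rel h k, Matrix.mul_smul, ← mul_assoc, h, Matrix.smul_mul, smul_smul,
      mul_assoc, ← pow_succ', ← pow_succ]

/-- The transvection of a table: `A' = T A Tᵀ`, `T = 1 + c E_{ij}` (row `i` += `c`·row `j`, same for columns),
written entrywise for alternating `A`. [cite: Gonzalezarroyo1998, §4.2] -/
def transvec {R : Type*} [CommRing R] (A : Matrix (Fin 4) (Fin 4) R) (i j : Fin 4) (c : R) : Matrix (Fin 4) (Fin 4) R :=
  fun k l => A k l + (if k = i then c * A j l else 0) + (if l = i then c * A k j else 0)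

section Transvec

variable {R : Type*} [CommRing R] (A : Matrix (Fin 4) (Fin 4) R) (i j : Fin 4) (c : R)

/-- Entry formula of a transvection. [folklore] -/
private theorem transvec_apply (k l : Fin 4) :
    transvec A i j c k l = A k l + (if k = i then c * A j l else 0) + (if l = i then c * A k j else 0) := rfl

/-- Entries off row/column `i` are unchanged. [folklore] -/
private theorem transvec_of_ne_of_ne (k l : Fin 4) (hk : k ≠ i) (hl : l ≠ i) : transvec A i j c k l = A k l := by
  simp [transvec, hk, hl]

/-- Row `i` of a transvection. [folklore] -/
private theorem transvec_left {l : Fin 4} (hl : l ≠ i) : transvec A i j c i l = A i l + c * A j l := by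
  simp [transvec, hl]

/-- Column `i` of a transvection. [folklore] -/
private theorem transvec_right {k : Fin 4} (hk : k ≠ i) : transvec A i j c k i = A k i + c * A k j := by
  simp [transvec, hk]

/-- The `(i,i)` entry of a transvection. [folklore] -/
private theorem transvec_self : transvec A i j c i i = A i i + c * A j i + c * A i j := by
  simp [transvec]

variable {A i j c}

/-- Transvections preserve alternation. [folklore] -/
private theorem IsAlt.transvec (hA : IsAlt A) : IsAlt (transvec A i j c) := by
  refine ⟨fun k => ?_, fun k l => ?_⟩
  · by_cases hk : k = i
    · subst hk; rw [transvec_self, hA.1, hA.2 k j]; ring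
    · rw [transvec_of_ne_of_ne A i j c k k hk hk, hA.1]
  · rw [transvec_apply, transvec_apply, hA.2 k l, hA.2 k j, hA.2 j l]
    by_cases hk : k = i <;> by_cases hl : l = i <;> simp [hk, hl] <;> ring

/-- The transvection by `-c` undoes the one by `c`. [folklore] -/
private theorem transvec_transvec_neg (hA : IsAlt A) (hij : i ≠ j) : transvec (transvec A i j c) i j (-c) = A := by
  ext k l
  have hj : transvec A i j c j l = A j l + (if l = i then c * A j j else 0) := by
    simp [transvec, hij.symm]
  have hj' : transvec A i j c k j = A k j + (if k = i then c * A j j else 0) := by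
    simp [transvec, hij.symm]
  rw [transvec_apply, hj, hj', hA.1 j, transvec_apply]
  by_cases hk : k = i <;> by_cases hl : l = i <;> simp [hk, hl]; ring

end Transvec

/-- Alternating matrices from their six upper entries. [folklore] -/
private def alt6 {R : Type*} [CommRing R] (a b c d e f : R) : Matrix (Fin 4) (Fin 4) R :=
  !![0, a, b, c; -a, 0, d, e; -b, -d, 0, f; -c, -e, -f, 0]

/-- An alternating matrix is `alt6` of its upper entries. [folklore] -/
private theorem IsAlt.eq_alt6 {R : Type*} [CommRing R] {A : Matrix (Fin 4) (Fin 4) R} (hA : IsAlt A) :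
    A = alt6 (A 0 1) (A 0 2) (A 0 3) (A 1 2) (A 1 3) (A 2 3) := by
  ext i j
  fin_cases i <;> fin_cases j <;> simp [alt6, hA.1] <;> exact hA.2 _ _

/-- `Pf(T A Tᵀ) = Pf(A)` for a transvection `T` (`det T = 1`). [cite: Gonzalezarroyo1998, §4.2] -/
private theorem pf_transvec {R : Type*} [CommRing R] {A : Matrix (Fin 4) (Fin 4) R} (hA : IsAlt A) {i j : Fin 4}
    (hij : i ≠ j) (c : R) : pf (transvec A i j c) = pf A := by
  rw [hA.eq_alt6]
  fin_cases i <;> fin_cases j <;> first | exact absurd rfl hij | (simp [pf, transvec, alt6]; ring)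

/-! Index permutations used by the reduction, with their effect on the Pfaffian. -/

/-- `σ₁₂ = (1 2)`: brings entry `(0,2)` to `(0,1)`. [folklore] -/
private def σ12 : Equiv.Perm (Fin 4) := Equiv.swap 1 2
/-- `σ₁₃ = (1 3)`: brings entry `(0,3)` to `(0,1)`. [folklore] -/
private def σ13 : Equiv.Perm (Fin 4) := Equiv.swap 1 3
/-- `σ_c`: `0 ↦ 1, 1 ↦ 2` — brings entry `(1,2)` to `(0,1)`. [folklore] -/
private def σc : Equiv.Perm (Fin 4) := Equiv.swap 0 1 * Equiv.swap 1 2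
/-- `σ_d`: `0 ↦ 1, 1 ↦ 3` — brings entry `(1,3)` to `(0,1)`. [folklore] -/
private def σd : Equiv.Perm (Fin 4) := Equiv.swap 0 1 * Equiv.swap 1 3

/-- `Pf` under `σ₁₂` (odd). [folklore] -/
private theorem pf_submatrix_σ12 {R : Type*} [CommRing R] {A : Matrix (Fin 4) (Fin 4) R} (hA : IsAlt A) :
    pf (A.submatrix σ12 σ12) = -pf A := by
  rw [hA.eq_alt6]; simp [pf, alt6, σ12, Equiv.swap_apply_def]; ring

/-- `Pf` under `σ₁₃` (odd). [folklore] -/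
private theorem pf_submatrix_σ13 {R : Type*} [CommRing R] {A : Matrix (Fin 4) (Fin 4) R} (hA : IsAlt A) :
    pf (A.submatrix σ13 σ13) = -pf A := by
  rw [hA.eq_alt6]; simp [pf, alt6, σ13, Equiv.swap_apply_def]; ring

/-- `Pf` under `σ_c` (even). [folklore] -/
private theorem pf_submatrix_σc {R : Type*} [CommRing R] {A : Matrix (Fin 4) (Fin 4) R} (hA : IsAlt A) :
    pf (A.submatrix σc σc) = pf A := by
  rw [hA.eq_alt6]; simp [pf, alt6, σc, Equiv.swap_apply_def]; ring

/-- `Pf` under `σ_d` (even). [folklore] -/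
private theorem pf_submatrix_σd {R : Type*} [CommRing R] {A : Matrix (Fin 4) (Fin 4) R} (hA : IsAlt A) :
    pf (A.submatrix σd σd) = pf A := by
  rw [hA.eq_alt6]; simp [pf, alt6, σd, Equiv.swap_apply_def]; ring

/-- Relabelling preserves alternation. [folklore] -/
private theorem IsAlt.submatrix {R : Type*} [CommRing R] {A : Matrix (Fin 4) (Fin 4) R} (hA : IsAlt A)
    (σ : Equiv.Perm (Fin 4)) : IsAlt (A.submatrix σ σ) :=
  ⟨fun i => hA.1 (σ i), fun i j => hA.2 (σ i) (σ j)⟩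

/-! Transport of eaters along the moves. -/

/-- Relabelling the generators. [folklore] -/
private theorem EaterRel.submatrix {A : Matrix (Fin 4) (Fin 4) (ZMod N)} {Γ : Fin 4 → SUN N} (h : EaterRel A Γ)
    (σ : Equiv.Perm (Fin 4)) : EaterRel (A.submatrix σ σ) (Γ ∘ σ) :=
  fun μ ν => h (σ μ) (σ ν)

/-- **The generator change `Γ_i ↦ Γ_i Γ_j^c` eats the transvected table** (central commutators are
bimultiplicative). [cite: Gonzalezarroyo1998, §4.2] -/
private theorem EaterRel.transvec [NeZero N] {A : Matrix (Fin 4) (Fin 4) (ZMod N)} {Γ : Fin 4 → SUN N}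
    (h : EaterRel A Γ) {i j : Fin 4} (hij : i ≠ j) (c : ZMod N) :
    EaterRel (transvec A i j c) (Function.update Γ i (Γ i * Γ j ^ c.val)) := by
  have hA := h.isAlt
  intro μ ν
  by_cases hμ : μ = i <;> by_cases hν : ν = i
  · subst hμ; subst hν
    rw [transvec_self, hA.1, hA.2 ν j]
    have : (0 : ZMod N) + c * -A ν j + c * A ν j = 0 := by ring
    rw [this, centerPhase_zero, one_smul]
  · subst hμ
    rw [Function.update_self, Function.update_of_ne hν, transvec_left A μ j c hν, centerPhase_add,
      centerPhase_mul]
    push_cast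
    rw [mul_assoc, pow_mul_of_rel (h j ν) c.val, Matrix.mul_smul, ← mul_assoc, h μ ν, Matrix.smul_mul,
      smul_smul, mul_assoc, mul_comm (centerPhase N (A j ν) ^ c.val)]
  · subst hν
    rw [Function.update_self, Function.update_of_ne hμ, transvec_right A ν j c hμ, centerPhase_add,
      centerPhase_mul]
    push_cast
    rw [← mul_assoc, h μ ν, Matrix.smul_mul, mul_assoc, mul_pow_of_rel (h μ j) c.val, Matrix.mul_smul,
      smul_smul, ← mul_assoc]
  · rw [Function.update_of_ne hμ, Function.update_of_ne hν, transvec_of_ne_of_ne A i j c μ ν hμ hν]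
    exact h μ ν

/-! ### Reduction to the canonical form `A₀₂ = A₀₃ = A₁₂ = A₁₃ = 0` -/

/-- Canonical tables: only the `(0,1)` and `(2,3)` blocks. [cite: Gonzalezarroyo1998, §4.2] -/
def IsCanon {R : Type*} [CommRing R] (A : Matrix (Fin 4) (Fin 4) R) : Prop :=
  A 0 2 = 0 ∧ A 0 3 = 0 ∧ A 1 2 = 0 ∧ A 1 3 = 0

/-- `A` reaches a canonical alternating table along eater- and Pfaffian-preserving moves. [folklore] -/
private def CanonReach (A : Matrix (Fin 4) (Fin 4) (ZMod N)) : Prop :=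
  ∃ B : Matrix (Fin 4) (Fin 4) (ZMod N), IsCanon B ∧ IsAlt B ∧
    ((∃ Γ : Fin 4 → SUN N, EaterRel A Γ) ↔ ∃ Γ : Fin 4 → SUN N, EaterRel B Γ) ∧ (pf A = 0 ↔ pf B = 0)

/-- Canonical tables reach themselves. [folklore] -/
private theorem canonReach_of_isCanon {A : Matrix (Fin 4) (Fin 4) (ZMod N)} (hA : IsAlt A) (hc : IsCanon A) :
    CanonReach A :=
  ⟨A, hc, hA, Iff.rfl, Iff.rfl⟩

/-- Transport of `CanonReach` back along a transvection. [folklore] -/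
private theorem canonReach_of_transvec [NeZero N] {A : Matrix (Fin 4) (Fin 4) (ZMod N)} (hA : IsAlt A) {i j : Fin 4}
    (hij : i ≠ j) (c : ZMod N) (h : CanonReach (transvec A i j c)) : CanonReach A := by
  obtain ⟨B, hB, hBalt, he, hp⟩ := h
  refine ⟨B, hB, hBalt, ?_, ?_⟩
  · rw [← he]
    constructor
    · rintro ⟨Γ, hΓ⟩; exact ⟨_, hΓ.transvec hij c⟩
    · rintro ⟨Γ, hΓ⟩
      have := hΓ.transvec hij (-c)
      rw [transvec_transvec_neg hA hij] at this
      exact ⟨_, this⟩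
  · rw [← hp, pf_transvec hA hij]

/-- Transport of `CanonReach` back along a relabelling. [folklore] -/
private theorem canonReach_of_perm {A : Matrix (Fin 4) (Fin 4) (ZMod N)} (σ : Equiv.Perm (Fin 4))
    (hpf : pf (A.submatrix σ σ) = pf A ∨ pf (A.submatrix σ σ) = -pf A) (h : CanonReach (A.submatrix σ σ)) :
    CanonReach A := by
  obtain ⟨B, hB, hBalt, he, hp⟩ := h
  refine ⟨B, hB, hBalt, ?_, ?_⟩
  · rw [← he]
    constructor
    · rintro ⟨Γ, hΓ⟩; exact ⟨_, hΓ.submatrix σ⟩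
    · rintro ⟨Γ, hΓ⟩
      have := hΓ.submatrix σ.symm
      rw [Matrix.submatrix_submatrix, Equiv.self_comp_symm, Matrix.submatrix_id_id] at this
      exact ⟨_, this⟩
  · rw [← hp]
    rcases hpf with hpf | hpf
    · rw [hpf]
    · rw [hpf, neg_eq_zero]

/-- Division with remainder on representatives in `ℤ/N`. [folklore] -/
private theorem exists_val_sub_mul_lt [NeZero N] (x y : ZMod N) (hy : y ≠ 0) : ∃ q : ZMod N, (x - q * y).val < y.val := by
  have hy' : 0 < y.val := Nat.pos_of_ne_zero fun h => hy ((ZMod.val_eq_zero y).1 h)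
  obtain ⟨q, r, hr, hxqr⟩ : ∃ q r : ℕ, r < y.val ∧ x.val = q * y.val + r :=
    ⟨x.val / y.val, x.val % y.val, Nat.mod_lt _ hy', (Nat.div_add_mod' x.val y.val).symm⟩
  refine ⟨(q : ZMod N), ?_⟩
  have hx : x = (q : ZMod N) * y + (r : ZMod N) := by
    conv_lhs => rw [← ZMod.natCast_zmod_val x, hxqr]
    push_cast
    rw [ZMod.natCast_zmod_val]
  rw [hx, add_sub_cancel_left, ZMod.val_natCast, Nat.mod_eq_of_lt (hr.trans (ZMod.val_lt y))]
  exact hr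

/-- Number of non-zero off-block ("cross") entries. [folklore] -/
private def crossCount (A : Matrix (Fin 4) (Fin 4) (ZMod N)) : ℕ :=
  (if A 0 2 = 0 then 0 else 1) + (if A 0 3 = 0 then 0 else 1) + (if A 1 2 = 0 then 0 else 1) +
    (if A 1 3 = 0 then 0 else 1)

/-- At most four cross entries. [folklore] -/
private theorem crossCount_le (A : Matrix (Fin 4) (Fin 4) (ZMod N)) : crossCount A ≤ 4 := by
  simp only [crossCount]; split_ifs <;> omega

/-- The reduction measure: `5·(A₀₁).val + #{non-zero cross entries}`. [folklore] -/
private def meas (A : Matrix (Fin 4) (Fin 4) (ZMod N)) : ℕ := 5 * (A 0 1).val + crossCount A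

/-- **Euclidean reduction** (main step): every alternating table with `A₀₁ ≠ 0` reaches a canonical one.
[cite: Gonzalezarroyo1998, §4.2] -/
private theorem canonReach_of_ne_zero [NeZero N] : ∀ (m : ℕ) (A : Matrix (Fin 4) (Fin 4) (ZMod N)),
    IsAlt A → A 0 1 ≠ 0 → meas A = m → CanonReach A := by
  intro m
  induction m using Nat.strong_induction_on with
  | _ m ih =>
  intro A hA h01 hm
  by_cases hc : IsCanon A
  · exact canonReach_of_isCanon hA hc
  -- the value of `A₀₁` and the generic "remainder moved to (0,1)" step
  have key : ∀ (A1 : Matrix (Fin 4) (Fin 4) (ZMod N)) (σ : Equiv.Perm (Fin 4)), IsAlt A1 →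
      (pf (A1.submatrix σ σ) = pf A1 ∨ pf (A1.submatrix σ σ) = -pf A1) →
      A1 (σ 0) (σ 1) ≠ 0 → (A1 (σ 0) (σ 1)).val < (A 0 1).val → CanonReach A1 := by
    intro A1 σ hA1 hpf hne hlt
    refine canonReach_of_perm σ hpf (ih (meas (A1.submatrix σ σ)) ?_ _ (hA1.submatrix σ) hne rfl)
    have h4 := crossCount_le (A1.submatrix σ σ)
    rw [← hm, meas, meas, Matrix.submatrix_apply]
    omega
  simp only [IsCanon, not_and_or] at hc
  rcases hc with h02 | h03 | h12 | h13
  · -- clear (0,2) with Γ₂ ↦ Γ₂ Γ₁^{-q}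
    obtain ⟨q, hq⟩ := exists_val_sub_mul_lt (A 0 2) (A 0 1) h01
    have hA1 : IsAlt (transvec A 2 1 (-q)) := hA.transvec
    have e01 : transvec A 2 1 (-q) 0 1 = A 0 1 := transvec_of_ne_of_ne A 2 1 (-q) 0 1 (by decide) (by decide)
    have e02 : transvec A 2 1 (-q) 0 2 = A 0 2 - q * A 0 1 := by
      rw [transvec_right A 2 1 (-q) (k := 0) (by decide)]; ring
    have e03 : transvec A 2 1 (-q) 0 3 = A 0 3 := transvec_of_ne_of_ne A 2 1 (-q) 0 3 (by decide) (by decide)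
    have e12 : transvec A 2 1 (-q) 1 2 = A 1 2 := by rw [transvec_right A 2 1 (-q) (k := 1) (by decide), hA.1]; ring
    have e13 : transvec A 2 1 (-q) 1 3 = A 1 3 := transvec_of_ne_of_ne A 2 1 (-q) 1 3 (by decide) (by decide)
    refine canonReach_of_transvec hA (i := 2) (j := 1) (by decide) (-q) ?_
    by_cases hz : transvec A 2 1 (-q) 0 2 = 0
    · refine ih (meas (transvec A 2 1 (-q))) ?_ _ hA1 (by rwa [e01]) rfl
      rw [← hm, meas, meas, crossCount, crossCount, e01, hz, e03, e12, e13]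
      rw [if_pos rfl, if_neg h02]
      omega
    · exact key _ σ12 hA1 (Or.inr (pf_submatrix_σ12 hA1)) (by simpa [σ12, Equiv.swap_apply_def] using hz)
        (by simpa [σ12, Equiv.swap_apply_def, e02] using hq)
  · -- clear (0,3) with Γ₃ ↦ Γ₃ Γ₁^{-q}
    obtain ⟨q, hq⟩ := exists_val_sub_mul_lt (A 0 3) (A 0 1) h01
    have hA1 : IsAlt (transvec A 3 1 (-q)) := hA.transvec
    have e01 : transvec A 3 1 (-q) 0 1 = A 0 1 := transvec_of_ne_of_ne A 3 1 (-q) 0 1 (by decide) (by decide)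
    have e03 : transvec A 3 1 (-q) 0 3 = A 0 3 - q * A 0 1 := by
      rw [transvec_right A 3 1 (-q) (k := 0) (by decide)]; ring
    have e02 : transvec A 3 1 (-q) 0 2 = A 0 2 := transvec_of_ne_of_ne A 3 1 (-q) 0 2 (by decide) (by decide)
    have e12 : transvec A 3 1 (-q) 1 2 = A 1 2 := transvec_of_ne_of_ne A 3 1 (-q) 1 2 (by decide) (by decide)
    have e13 : transvec A 3 1 (-q) 1 3 = A 1 3 := by rw [transvec_right A 3 1 (-q) (k := 1) (by decide), hA.1]; ring
    refine canonReach_of_transvec hA (i := 3) (j := 1) (by decide) (-q) ?_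
    by_cases hz : transvec A 3 1 (-q) 0 3 = 0
    · refine ih (meas (transvec A 3 1 (-q))) ?_ _ hA1 (by rwa [e01]) rfl
      rw [← hm, meas, meas, crossCount, crossCount, e01, hz, e02, e12, e13]
      rw [if_pos rfl, if_neg h03]
      omega
    · exact key _ σ13 hA1 (Or.inr (pf_submatrix_σ13 hA1)) (by simpa [σ13, Equiv.swap_apply_def] using hz)
        (by simpa [σ13, Equiv.swap_apply_def, e03] using hq)
  · -- clear (1,2) with Γ₂ ↦ Γ₂ Γ₀^{q}
    obtain ⟨q, hq⟩ := exists_val_sub_mul_lt (A 1 2) (A 0 1) h01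
    have hA1 : IsAlt (transvec A 2 0 q) := hA.transvec
    have e01 : transvec A 2 0 q 0 1 = A 0 1 := transvec_of_ne_of_ne A 2 0 q 0 1 (by decide) (by decide)
    have e12 : transvec A 2 0 q 1 2 = A 1 2 - q * A 0 1 := by
      rw [transvec_right A 2 0 q (k := 1) (by decide), hA.2 0 1]; ring
    have e02 : transvec A 2 0 q 0 2 = A 0 2 := by rw [transvec_right A 2 0 q (k := 0) (by decide), hA.1]; ring
    have e03 : transvec A 2 0 q 0 3 = A 0 3 := transvec_of_ne_of_ne A 2 0 q 0 3 (by decide) (by decide)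
    have e13 : transvec A 2 0 q 1 3 = A 1 3 := transvec_of_ne_of_ne A 2 0 q 1 3 (by decide) (by decide)
    refine canonReach_of_transvec hA (i := 2) (j := 0) (by decide) q ?_
    by_cases hz : transvec A 2 0 q 1 2 = 0
    · refine ih (meas (transvec A 2 0 q)) ?_ _ hA1 (by rwa [e01]) rfl
      rw [← hm, meas, meas, crossCount, crossCount, e01, hz, e02, e03, e13]
      rw [if_pos rfl, if_neg h12]
      omega
    · exact key _ σc hA1 (Or.inl (pf_submatrix_σc hA1))
        (by simpa [σc, Equiv.swap_apply_def, Equiv.Perm.mul_apply] using hz)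
        (by simpa [σc, Equiv.swap_apply_def, Equiv.Perm.mul_apply, e12] using hq)
  · -- clear (1,3) with Γ₃ ↦ Γ₃ Γ₀^{q}
    obtain ⟨q, hq⟩ := exists_val_sub_mul_lt (A 1 3) (A 0 1) h01
    have hA1 : IsAlt (transvec A 3 0 q) := hA.transvec
    have e01 : transvec A 3 0 q 0 1 = A 0 1 := transvec_of_ne_of_ne A 3 0 q 0 1 (by decide) (by decide)
    have e13 : transvec A 3 0 q 1 3 = A 1 3 - q * A 0 1 := by
      rw [transvec_right A 3 0 q (k := 1) (by decide), hA.2 0 1]; ring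
    have e02 : transvec A 3 0 q 0 2 = A 0 2 := transvec_of_ne_of_ne A 3 0 q 0 2 (by decide) (by decide)
    have e03 : transvec A 3 0 q 0 3 = A 0 3 := by rw [transvec_right A 3 0 q (k := 0) (by decide), hA.1]; ring
    have e12 : transvec A 3 0 q 1 2 = A 1 2 := transvec_of_ne_of_ne A 3 0 q 1 2 (by decide) (by decide)
    refine canonReach_of_transvec hA (i := 3) (j := 0) (by decide) q ?_
    by_cases hz : transvec A 3 0 q 1 3 = 0
    · refine ih (meas (transvec A 3 0 q)) ?_ _ hA1 (by rwa [e01]) rfl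
      rw [← hm, meas, meas, crossCount, crossCount, e01, hz, e02, e03, e12]
      rw [if_pos rfl, if_neg h13]
      omega
    · exact key _ σd hA1 (Or.inl (pf_submatrix_σd hA1))
        (by simpa [σd, Equiv.swap_apply_def, Equiv.Perm.mul_apply] using hz)
        (by simpa [σd, Equiv.swap_apply_def, Equiv.Perm.mul_apply, e13] using hq)

/-- **Every alternating table reaches a canonical one** (symplectic-type normal form over `ℤ/N`).
[cite: Gonzalezarroyo1998, §4.2] -/
private theorem canonReach [NeZero N] (A : Matrix (Fin 4) (Fin 4) (ZMod N)) (hA : IsAlt A) : CanonReach A := by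
  by_cases hc : IsCanon A
  · exact canonReach_of_isCanon hA hc
  simp only [IsCanon, not_and_or] at hc
  rcases hc with h | h | h | h
  · exact canonReach_of_perm σ12 (Or.inr (pf_submatrix_σ12 hA))
      (canonReach_of_ne_zero _ _ (hA.submatrix σ12) (by simpa [σ12, Equiv.swap_apply_def] using h) rfl)
  · exact canonReach_of_perm σ13 (Or.inr (pf_submatrix_σ13 hA))
      (canonReach_of_ne_zero _ _ (hA.submatrix σ13) (by simpa [σ13, Equiv.swap_apply_def] using h) rfl)
  · exact canonReach_of_perm σc (Or.inl (pf_submatrix_σc hA))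
      (canonReach_of_ne_zero _ _ (hA.submatrix σc)
        (by simpa [σc, Equiv.swap_apply_def, Equiv.Perm.mul_apply] using h) rfl)
  · exact canonReach_of_perm σd (Or.inl (pf_submatrix_σd hA))
      (canonReach_of_ne_zero _ _ (hA.submatrix σd)
        (by simpa [σd, Equiv.swap_apply_def, Equiv.Perm.mul_apply] using h) rfl)


end Table

/-! ### The canonical case, existence: clock and shift matrices -/

section Construction

variable {N : ℕ}

/-- `‖ω_N‖ = 1`. [folklore] -/
private theorem norm_rootω : ‖rootω N‖ = 1 := by
  have : rootω N = Complex.exp (((2 * Real.pi / N : ℝ)) * Complex.I) := by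
    rw [rootω]; congr 1; push_cast; ring
  rw [this, Complex.norm_exp_ofReal_mul_I]

/-- `(ω^k) · conj(ω^k) = 1`. [folklore] -/
private theorem rootω_pow_mul_conj (k : ℕ) : rootω N ^ k * (starRingEnd ℂ) (rootω N ^ k) = 1 := by
  rw [Complex.mul_conj, Complex.normSq_eq_norm_sq, norm_pow, norm_rootω, one_pow, one_pow, Complex.ofReal_one]

/-- `q^(n mod p) = q^n` when `q^p = 1`. [folklore] -/
private theorem pow_mod_eq_of_pow_eq_one {q : ℂ} {p : ℕ} (hq : q ^ p = 1) (n : ℕ) : q ^ (n % p) = q ^ n := by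
  conv_rhs => rw [← Nat.div_add_mod n p, pow_add, pow_mul, hq, one_pow, one_mul]

/-- Clock periodicity: `q^{(x+1).val} = q · q^{x.val}` in `ℤ/p` when `q^p = 1`. [folklore] -/
private theorem pow_val_add_one {q : ℂ} {p : ℕ} [NeZero p] (hq : q ^ p = 1) (x : ZMod p) :
    q ^ (x + 1).val = q * q ^ x.val := by
  rw [ZMod.val_add, pow_mod_eq_of_pow_eq_one hq, pow_add, ZMod.val_one_eq_one_mod, pow_mod_eq_of_pow_eq_one hq,
    pow_one, mul_comm]

/-- Weyl relation «shift × clock»: `P D = φ D P` when `d ∘ σ = φ d`. [folklore] -/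
private theorem perm_mul_diagonal {ι : Type*} [Fintype ι] [DecidableEq ι] (σ : ι ≃ ι) (d : ι → ℂ) (φ : ℂ)
    (h : ∀ i, d (σ i) = φ * d i) :
    σ.toPEquiv.toMatrix * Matrix.diagonal d = φ • (Matrix.diagonal d * σ.toPEquiv.toMatrix) := by
  ext i j
  rw [PEquiv.toMatrix_toPEquiv_mul, Matrix.smul_apply, PEquiv.mul_toMatrix_toPEquiv]
  simp only [Matrix.submatrix_apply, id, Matrix.diagonal_apply, smul_eq_mul]
  by_cases hij : σ i = j
  · subst hij
    simp [h]
  · have hne : i ≠ σ.symm j := fun h' => hij (by rw [h', Equiv.apply_symm_apply])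
    simp [hij, hne]

/-- Commuting shifts. [folklore] -/
private theorem perm_mul_perm_comm {ι : Type*} [Fintype ι] [DecidableEq ι] (σ τ : ι ≃ ι)
    (h : ∀ i, σ (τ i) = τ (σ i)) :
    σ.toPEquiv.toMatrix * τ.toPEquiv.toMatrix = (τ.toPEquiv.toMatrix * σ.toPEquiv.toMatrix : Matrix ι ι ℂ) := by
  rw [← PEquiv.toMatrix_trans, ← PEquiv.toMatrix_trans, ← Equiv.toPEquiv_trans, ← Equiv.toPEquiv_trans]
  congr 2
  ext i
  exact (h i).symm

/-- Conjugate transpose of a permutation matrix is the inverse permutation matrix. [folklore] -/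
private theorem conjTranspose_perm {ι : Type*} [Fintype ι] [DecidableEq ι] (σ : ι ≃ ι) :
    (σ.toPEquiv.toMatrix : Matrix ι ι ℂ).conjTranspose = σ.symm.toPEquiv.toMatrix := by
  rw [Equiv.toPEquiv_symm, PEquiv.toMatrix_symm]
  ext i j
  simp only [Matrix.conjTranspose_apply, Matrix.transpose_apply, PEquiv.toMatrix_apply]
  split_ifs <;> simp

/-- Permutation matrices are unitary. [folklore] -/
private theorem perm_mem_unitaryGroup {ι : Type*} [Fintype ι] [DecidableEq ι] (σ : ι ≃ ι) :
    (σ.toPEquiv.toMatrix : Matrix ι ι ℂ) ∈ Matrix.unitaryGroup ι ℂ := by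
  rw [Matrix.mem_unitaryGroup_iff, Matrix.star_eq_conjTranspose, conjTranspose_perm, ← PEquiv.toMatrix_trans,
    ← Equiv.toPEquiv_trans, Equiv.self_trans_symm, Equiv.toPEquiv_refl, PEquiv.toMatrix_refl]

/-- Diagonal matrices of `ω`-powers are unitary. [folklore] -/
private theorem diagonal_mem_unitaryGroup {ι : Type*} [Fintype ι] [DecidableEq ι] (k : ι → ℕ) :
    Matrix.diagonal (fun i => rootω N ^ k i) ∈ Matrix.unitaryGroup ι ℂ := by
  rw [Matrix.mem_unitaryGroup_iff, Matrix.star_eq_conjTranspose, Matrix.diagonal_conjTranspose,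
    Matrix.diagonal_mul_diagonal, ← Matrix.diagonal_one]
  congr 1
  funext i
  exact rootω_pow_mul_conj (k i)

/-- A unitary matrix has a determinant of modulus one. [folklore] -/
private theorem norm_det_of_mem_unitaryGroup {n : Type*} [Fintype n] [DecidableEq n] {M : Matrix n n ℂ}
    (hM : M ∈ Matrix.unitaryGroup n ℂ) : ‖M.det‖ = 1 := by
  have h := congrArg Matrix.det (Matrix.mem_unitaryGroup_iff.1 hM)
  rw [Matrix.det_mul, Matrix.star_eq_conjTranspose, Matrix.det_conjTranspose, Matrix.det_one, Complex.star_def,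
    Complex.mul_conj, Complex.normSq_eq_norm_sq] at h
  have h' : ‖M.det‖ ^ 2 = 1 := by exact_mod_cast h
  nlinarith [norm_nonneg M.det]

/-- Rescaling a unitary `N × N` matrix into `SU(N)` by an `N`-th root of `det⁻¹`. [folklore] -/
private theorem exists_smul_mem_specialUnitaryGroup [NeZero N] {M : Matrix (Fin N) (Fin N) ℂ}
    (hM : M ∈ Matrix.unitaryGroup (Fin N) ℂ) : ∃ c : ℂ, c • M ∈ Matrix.specialUnitaryGroup (Fin N) ℂ := by
  have hδ1 : ‖M.det‖ = 1 := norm_det_of_mem_unitaryGroup hM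
  obtain ⟨θ, hθ⟩ : ∃ θ : ℝ, M.det = Complex.exp (θ * Complex.I) :=
    ⟨M.det.arg, by
      have := Complex.norm_mul_exp_arg_mul_I M.det
      rw [hδ1, Complex.ofReal_one, one_mul] at this
      exact this.symm⟩
  refine ⟨Complex.exp ((-(θ / N) : ℝ) * Complex.I), Matrix.mem_specialUnitaryGroup_iff.2 ⟨?_, ?_⟩⟩
  · have hc1 : ‖Complex.exp ((-(θ / N) : ℝ) * Complex.I)‖ = 1 := Complex.norm_exp_ofReal_mul_I _
    rw [Matrix.mem_unitaryGroup_iff] at hM ⊢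
    rw [star_smul, Matrix.smul_mul, Matrix.mul_smul, smul_smul, hM, Complex.star_def, Complex.mul_conj,
      Complex.normSq_eq_norm_sq, hc1]
    simp
  · rw [Matrix.det_smul, Fintype.card_fin, hθ, ← Complex.exp_nat_mul, ← Complex.exp_add, ← Complex.exp_zero]
    congr 1
    have hN : (N : ℂ) ≠ 0 := Nat.cast_ne_zero.2 (NeZero.ne N)
    push_cast
    field_simp
    ring

/-- Relations survive reindexing and rescaling. [folklore] -/
private theorem rel_smul_submatrix {ι : Type*} [Fintype ι] {M₁ M₂ : Matrix ι ι ℂ} {φ : ℂ}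
    (h : M₁ * M₂ = φ • (M₂ * M₁)) (e : Fin N ≃ ι) (c₁ c₂ : ℂ) :
    (c₁ • M₁.submatrix e e) * (c₂ • M₂.submatrix e e) = φ • ((c₂ • M₂.submatrix e e) * (c₁ • M₁.submatrix e e)) := by
  rw [Matrix.smul_mul, Matrix.mul_smul, Matrix.smul_mul, Matrix.mul_smul, Matrix.submatrix_mul_equiv,
    Matrix.submatrix_mul_equiv, h, Matrix.submatrix_smul]
  simp only [smul_smul, Pi.smul_apply]
  ring_nf

/-- The six ordered pairs `μ < ν` in `Fin 4`. [folklore] -/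
private theorem fin4_lt_cases : ∀ {μ ν : Fin 4}, μ < ν →
    (μ = 0 ∧ ν = 1) ∨ (μ = 0 ∧ ν = 2) ∨ (μ = 0 ∧ ν = 3) ∨ (μ = 1 ∧ ν = 2) ∨ (μ = 1 ∧ ν = 3) ∨ (μ = 2 ∧ ν = 3) := by
  decide

/-- **Existence in the canonical case.** If `N ∣ a·b` (as representatives) then the canonical table
`A₀₁ = a`, `A₂₃ = b` has an eater in `SU(N)`: with `p₁ = N/gcd(a,N)`, `p₂ = N/gcd(b,N)`, `p₁ p₂ ∣ N`, and on
`ℂ^{p₁} ⊗ ℂ^{p₂} ⊗ ℂ^{N/(p₁p₂)}` the pairs (shift, clock^a) ⊗ 1 ⊗ 1 and 1 ⊗ (shift, clock^b) ⊗ 1, rescaled into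
`SU(N)`. [cite: Gonzalezarroyo1998, §4.2] -/
private theorem exists_eaterRel_of_canon [NeZero N] {B : Matrix (Fin 4) (Fin 4) (ZMod N)} (hB : IsAlt B)
    (hc : IsCanon B) (hab : B 0 1 * B 2 3 = 0) : ∃ Γ : Fin 4 → SUN N, EaterRel B Γ := by
  classical
  set a := B 0 1 with ha
  set b := B 2 3 with hb
  have hN0 : 0 < N := Nat.pos_of_ne_zero (NeZero.ne N)
  -- arithmetic: p₁ p₂ ∣ N
  set g₁ := Nat.gcd a.val N with hg₁
  set g₂ := Nat.gcd b.val N with hg₂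
  have hg₁N : g₁ ∣ N := Nat.gcd_dvd_right _ _
  have hg₂N : g₂ ∣ N := Nat.gcd_dvd_right _ _
  have hg₁a : g₁ ∣ a.val := Nat.gcd_dvd_left _ _
  have hg₂b : g₂ ∣ b.val := Nat.gcd_dvd_left _ _
  set p₁ := N / g₁ with hp₁
  set p₂ := N / g₂ with hp₂
  have hp₁N : p₁ * g₁ = N := Nat.div_mul_cancel hg₁N
  have hp₂N : p₂ * g₂ = N := Nat.div_mul_cancel hg₂N
  have hp₁0 : 0 < p₁ := Nat.pos_of_ne_zero (fun h => by rw [h, zero_mul] at hp₁N; omega)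
  have hp₂0 : 0 < p₂ := Nat.pos_of_ne_zero (fun h => by rw [h, zero_mul] at hp₂N; omega)
  haveI : NeZero p₁ := ⟨hp₁0.ne'⟩
  haveI : NeZero p₂ := ⟨hp₂0.ne'⟩
  have hab' : N ∣ a.val * b.val := by
    have h0 : (a * b).val = 0 := by rw [hab, ZMod.val_zero]
    rw [ZMod.val_mul] at h0
    exact Nat.dvd_of_mod_eq_zero h0
  have hNgg : N ∣ g₁ * g₂ := by
    have h1 : N ∣ a.val * g₂ := by
      rw [hg₂, ← Nat.gcd_mul_left]
      exact Nat.dvd_gcd hab' (dvd_mul_left N _)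
    have : g₁ * g₂ = Nat.gcd (a.val * g₂) (N * g₂) := by rw [Nat.gcd_mul_right]
    rw [this]
    exact Nat.dvd_gcd h1 (dvd_mul_right N _)
  obtain ⟨m, hm⟩ := hNgg
  have hNppm : N = p₁ * p₂ * m := by
    have h : N * N = N * (p₁ * p₂ * m) := by
      calc N * N = (p₁ * g₁) * (p₂ * g₂) := by rw [hp₁N, hp₂N]
        _ = p₁ * p₂ * (g₁ * g₂) := by ring
        _ = p₁ * p₂ * (N * m) := by rw [hm]
        _ = N * (p₁ * p₂ * m) := by ring
    exact Nat.eq_of_mul_eq_mul_left hN0 h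
  -- the phases
  set qa : ℂ := rootω N ^ a.val with hqa
  set qb : ℂ := rootω N ^ b.val with hqb
  have hqa1 : qa ^ p₁ = 1 := by
    rw [hqa, ← pow_mul, (rootω_isPrimitiveRoot N).pow_eq_one_iff_dvd]
    refine ⟨a.val / g₁, ?_⟩
    calc a.val * p₁ = (a.val / g₁ * g₁) * p₁ := by rw [Nat.div_mul_cancel hg₁a]
      _ = (p₁ * g₁) * (a.val / g₁) := by ring
      _ = N * (a.val / g₁) := by rw [hp₁N]
  have hqb1 : qb ^ p₂ = 1 := by
    rw [hqb, ← pow_mul, (rootω_isPrimitiveRoot N).pow_eq_one_iff_dvd]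
    refine ⟨b.val / g₂, ?_⟩
    calc b.val * p₂ = (b.val / g₂ * g₂) * p₂ := by rw [Nat.div_mul_cancel hg₂b]
      _ = (p₂ * g₂) * (b.val / g₂) := by ring
      _ = N * (b.val / g₂) := by rw [hp₂N]
  -- the index type and the four matrices
  let ι : Type := ZMod p₁ × ZMod p₂ × Fin m
  have hcard : Fintype.card ι = N := by
    simp only [ι, Fintype.card_prod, ZMod.card, Fintype.card_fin, hNppm, mul_assoc]
  let σ₁ : ι ≃ ι := Equiv.prodCongr (Equiv.addRight (1 : ZMod p₁)) (Equiv.refl _)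
  let σ₂ : ι ≃ ι := Equiv.prodCongr (Equiv.refl _) (Equiv.prodCongr (Equiv.addRight (1 : ZMod p₂)) (Equiv.refl _))
  let k₁ : ι → ℕ := fun i => a.val * i.1.val
  let k₂ : ι → ℕ := fun i => b.val * i.2.1.val
  let S₁ : Matrix ι ι ℂ := σ₁.toPEquiv.toMatrix
  let S₂ : Matrix ι ι ℂ := σ₂.toPEquiv.toMatrix
  let D₁ : Matrix ι ι ℂ := Matrix.diagonal fun i => rootω N ^ k₁ i
  let D₂ : Matrix ι ι ℂ := Matrix.diagonal fun i => rootω N ^ k₂ i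
  -- relations on ι
  have r01 : S₁ * D₁ = centerPhase N a • (D₁ * S₁) := by
    refine perm_mul_diagonal σ₁ _ _ fun i => ?_
    obtain ⟨x, y, z⟩ := i
    change rootω N ^ (a.val * (x + 1).val) = centerPhase N a * rootω N ^ (a.val * x.val)
    rw [pow_mul, pow_mul, centerPhase_eq_pow, ← hqa, pow_val_add_one hqa1]
  have r23 : S₂ * D₂ = centerPhase N b • (D₂ * S₂) := by
    refine perm_mul_diagonal σ₂ _ _ fun i => ?_
    obtain ⟨x, y, z⟩ := i
    change rootω N ^ (b.val * (y + 1).val) = centerPhase N b * rootω N ^ (b.val * y.val)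
    rw [pow_mul, pow_mul, centerPhase_eq_pow, ← hqb, pow_val_add_one hqb1]
  have r02 : S₁ * S₂ = (1 : ℂ) • (S₂ * S₁) := by
    rw [one_smul]
    exact perm_mul_perm_comm σ₁ σ₂ fun i => rfl
  have r03 : S₁ * D₂ = (1 : ℂ) • (D₂ * S₁) :=
    perm_mul_diagonal σ₁ (fun i => rootω N ^ k₂ i) 1 fun i => by
      obtain ⟨x, y, z⟩ := i
      change rootω N ^ (b.val * y.val) = 1 * rootω N ^ (b.val * y.val)
      rw [one_mul]
  have r12 : D₁ * S₂ = (1 : ℂ) • (S₂ * D₁) := by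
    have := perm_mul_diagonal σ₂ (fun i => rootω N ^ k₁ i) 1 fun i => by
      obtain ⟨x, y, z⟩ := i
      change rootω N ^ (a.val * x.val) = 1 * rootω N ^ (a.val * x.val)
      rw [one_mul]
    rw [one_smul] at this ⊢
    exact this.symm
  have r13 : D₁ * D₂ = (1 : ℂ) • (D₂ * D₁) := by
    rw [one_smul]
    simp only [D₁, D₂, Matrix.diagonal_mul_diagonal]
    congr 1; funext i; ring
  -- reindex to `Fin N` and rescale into `SU(N)`
  let e : Fin N ≃ ι := (Fintype.equivFinOfCardEq hcard).symm
  have hU : ∀ M : Matrix ι ι ℂ, M ∈ Matrix.unitaryGroup ι ℂ → M.submatrix e e ∈ Matrix.unitaryGroup (Fin N) ℂ := by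
    intro M hM
    rw [Matrix.mem_unitaryGroup_iff, Matrix.star_eq_conjTranspose] at hM ⊢
    rw [Matrix.conjTranspose_submatrix, Matrix.submatrix_mul_equiv, hM, Matrix.submatrix_one_equiv]
  obtain ⟨c₀, hc₀⟩ := exists_smul_mem_specialUnitaryGroup (hU S₁ (perm_mem_unitaryGroup σ₁))
  obtain ⟨c₁, hc₁⟩ := exists_smul_mem_specialUnitaryGroup (hU D₁ (diagonal_mem_unitaryGroup k₁))
  obtain ⟨c₂, hc₂⟩ := exists_smul_mem_specialUnitaryGroup (hU S₂ (perm_mem_unitaryGroup σ₂))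
  obtain ⟨c₃, hc₃⟩ := exists_smul_mem_specialUnitaryGroup (hU D₂ (diagonal_mem_unitaryGroup k₂))
  let Γ : Fin 4 → SUN N := ![⟨_, hc₀⟩, ⟨_, hc₁⟩, ⟨_, hc₂⟩, ⟨_, hc₃⟩]
  refine ⟨Γ, eaterRel_of_lt hB fun μ ν hμν => ?_⟩
  have h02 : B 0 2 = 0 := hc.1
  have h03 : B 0 3 = 0 := hc.2.1
  have h12 : B 1 2 = 0 := hc.2.2.1
  have h13 : B 1 3 = 0 := hc.2.2.2
  rcases fin4_lt_cases hμν with ⟨rfl, rfl⟩ | ⟨rfl, rfl⟩ | ⟨rfl, rfl⟩ | ⟨rfl, rfl⟩ | ⟨rfl, rfl⟩ | ⟨rfl, rfl⟩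
  · exact rel_smul_submatrix r01 e c₀ c₁
  · rw [h02, centerPhase_zero]
    exact rel_smul_submatrix r02 e c₀ c₂
  · rw [h03, centerPhase_zero]
    exact rel_smul_submatrix r03 e c₀ c₃
  · rw [h12, centerPhase_zero]
    exact rel_smul_submatrix r12 e c₁ c₂
  · rw [h13, centerPhase_zero]
    exact rel_smul_submatrix r13 e c₁ c₃
  · exact rel_smul_submatrix r23 e c₂ c₃


end Construction

/-! ### The canonical case, necessity: generalized eigenspaces of `Γ₀` -/

section Necessity

variable {N : ℕ}

/-- Matrix relations pass to the associated linear maps. [folklore] -/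
private theorem toLin'_rel {X Y : Matrix (Fin N) (Fin N) ℂ} {φ : ℂ} (h : X * Y = φ • (Y * X)) :
    Matrix.toLin' X * Matrix.toLin' Y = φ • (Matrix.toLin' Y * Matrix.toLin' X) := by
  rw [Module.End.mul_eq_comp, Module.End.mul_eq_comp, ← Matrix.toLin'_mul, ← Matrix.toLin'_mul, h, map_smul]

/-- An `SU(N)` matrix acts injectively. [folklore] -/
private theorem toLin'_injective (g : SUN N) : Function.Injective (Matrix.toLin' (g : Matrix (Fin N) (Fin N) ℂ)) := by
  have h1 : star (g : Matrix (Fin N) (Fin N) ℂ) * g = 1 :=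
    Matrix.mem_unitaryGroup_iff'.1 (Matrix.mem_specialUnitaryGroup_iff.1 g.2).1
  intro v w hvw
  have := congrArg (Matrix.toLin' (star (g : Matrix (Fin N) (Fin N) ℂ))) hvw
  rwa [← Matrix.toLin'_mul_apply, ← Matrix.toLin'_mul_apply, h1, Matrix.toLin'_one, LinearMap.id_apply,
    LinearMap.id_apply] at this

section Generic

variable {V : Type*} [AddCommGroup V] [Module ℂ V]

/-- `f g = c·g f` ⟹ `g` maps the generalized `μ`-eigenspace of `f` into the generalized `cμ`-eigenspace. [folklore] -/
private theorem mapsTo_maxGenEigenspace_of_rel {f g : Module.End ℂ V} {c : ℂ} (h : f * g = c • (g * f)) (μ : ℂ) :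
    Set.MapsTo g (f.maxGenEigenspace μ) (f.maxGenEigenspace (c * μ)) := by
  have hfg : ∀ v, f (g v) = c • g (f v) := fun v => by
    simpa [Module.End.mul_apply] using LinearMap.congr_fun h v
  set P : Module.End ℂ V := f - (c * μ) • (1 : Module.End ℂ V) with hP
  set Q : Module.End ℂ V := f - μ • (1 : Module.End ℂ V) with hQ
  have step : ∀ v, P (g v) = c • g (Q v) := by
    intro v
    simp only [hP, hQ, LinearMap.sub_apply, LinearMap.smul_apply, Module.End.one_apply, map_sub, map_smul, hfg,
      smul_sub, mul_smul]
  have key : ∀ (k : ℕ) (v : V), (P ^ k) (g v) = c ^ k • g ((Q ^ k) v) := by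
    intro k
    induction k with
    | zero => intro v; simp
    | succ k ih =>
      intro v
      calc (P ^ (k + 1)) (g v) = P ((P ^ k) (g v)) := by rw [pow_succ', Module.End.mul_apply]
        _ = P (c ^ k • g ((Q ^ k) v)) := by rw [ih]
        _ = c ^ k • (c • g (Q ((Q ^ k) v))) := by rw [map_smul, step]
        _ = c ^ (k + 1) • g ((Q ^ (k + 1)) v) := by
          rw [smul_smul, ← pow_succ, pow_succ' Q k, Module.End.mul_apply]
  intro x hx
  rw [SetLike.mem_coe, Module.End.mem_maxGenEigenspace] at hx ⊢
  obtain ⟨k, hk⟩ := hx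
  exact ⟨k, by rw [key, hk, map_zero, smul_zero]⟩

/-- Restricting an injective map keeps it injective. [folklore] -/
private theorem restrict_injective {g : Module.End ℂ V} (hg : Function.Injective g) {p q : Submodule ℂ V}
    (hpq : Set.MapsTo g p q) : Function.Injective (g.restrict hpq) := by
  intro x y hxy
  apply Subtype.ext
  apply hg
  simpa [LinearMap.restrict_apply] using congrArg Subtype.val hxy

variable [FiniteDimensional ℂ V]

/-- Along `μ ↦ cμ` the generalized-eigenspace dimensions are constant when `f g = c·g f`, `g` injective,
`c` of finite order. [folklore] -/
private theorem finrank_maxGenEigenspace_eq_of_rel {f g : Module.End ℂ V} {c : ℂ} (h : f * g = c • (g * f))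
    (hg : Function.Injective g) {p : ℕ} (hp : 0 < p) (hc : c ^ p = 1) (μ : ℂ) :
    Module.finrank ℂ (f.maxGenEigenspace (c * μ)) = Module.finrank ℂ (f.maxGenEigenspace μ) := by
  have hle : ∀ ν : ℂ, Module.finrank ℂ (f.maxGenEigenspace ν) ≤ Module.finrank ℂ (f.maxGenEigenspace (c * ν)) :=
    fun ν => LinearMap.finrank_le_finrank_of_injective
      (restrict_injective hg (mapsTo_maxGenEigenspace_of_rel h ν))
  have hmono : ∀ k : ℕ, Module.finrank ℂ (f.maxGenEigenspace (c * μ)) ≤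
      Module.finrank ℂ (f.maxGenEigenspace (c ^ (k + 1) * μ)) := by
    intro k
    induction k with
    | zero => rw [zero_add, pow_one]
    | succ k ih =>
      have := hle (c ^ (k + 1) * μ)
      rw [← mul_assoc, ← pow_succ'] at this
      exact ih.trans this
  have hp' := hmono (p - 1)
  rw [Nat.sub_add_cancel hp, hc, one_mul] at hp'
  exact le_antisymm hp' (hle μ)

/-- **Determinant trick on a generalized eigenspace**: if `w, x` commute with `f`, `w x = φ x w`, and `w, x`
are injective, then `φ^{dim E_μ(f)} = 1`. [folklore] -/
private theorem phase_pow_finrank_eq_one {f w x : Module.End ℂ V} {φ : ℂ} (hw : f * w = (1 : ℂ) • (w * f))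
    (hx : f * x = (1 : ℂ) • (x * f)) (hwx : w * x = φ • (x * w)) (hwi : Function.Injective w)
    (hxi : Function.Injective x) (μ : ℂ) : φ ^ Module.finrank ℂ (f.maxGenEigenspace μ) = 1 := by
  have hmw := mapsTo_maxGenEigenspace_of_rel hw μ
  have hmx := mapsTo_maxGenEigenspace_of_rel hx μ
  rw [one_mul] at hmw hmx
  have hrel : w.restrict hmw * x.restrict hmx = φ • (x.restrict hmx * w.restrict hmw) := by
    apply LinearMap.ext
    intro v
    apply Subtype.ext
    simpa [Module.End.mul_apply, LinearMap.restrict_apply] using LinearMap.congr_fun hwx (v : V)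
  have hw'u : IsUnit (w.restrict hmw) :=
    (LinearMap.isUnit_iff_ker_eq_bot _).2 (LinearMap.ker_eq_bot.2 (restrict_injective hwi hmw))
  have hx'u : IsUnit (x.restrict hmx) :=
    (LinearMap.isUnit_iff_ker_eq_bot _).2 (LinearMap.ker_eq_bot.2 (restrict_injective hxi hmx))
  have hdet := congrArg LinearMap.det hrel
  rw [map_mul, LinearMap.det_smul, map_mul, mul_comm (LinearMap.det (w.restrict hmw))] at hdet
  have hD : LinearMap.det (x.restrict hmx) * LinearMap.det (w.restrict hmw) ≠ 0 :=
    mul_ne_zero (hx'u.map LinearMap.det).ne_zero (hw'u.map LinearMap.det).ne_zero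
  exact mul_right_cancel₀ hD (by rw [one_mul]; exact hdet.symm)

/-- Generalized eigenspaces off the roots of the characteristic polynomial vanish. [folklore] -/
private theorem maxGenEigenspace_eq_bot_of_not_mem (f : Module.End ℂ V) {μ : ℂ}
    (hμ : μ ∉ f.charpoly.roots.toFinset) : f.maxGenEigenspace μ = ⊥ := by
  by_contra h
  refine hμ (Multiset.mem_toFinset.2 ((Polynomial.mem_roots (LinearMap.charpoly_monic f).ne_zero).2 ?_))
  exact (Module.End.hasEigenvalue_iff_isRoot_charpoly f μ).1 (Module.End.HasUnifEigenvalue.lt zero_lt_one h)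

/-- Roots of the characteristic polynomial carry non-trivial generalized eigenspaces. [folklore] -/
private theorem maxGenEigenspace_ne_bot_of_mem (f : Module.End ℂ V) {μ : ℂ}
    (hμ : μ ∈ f.charpoly.roots.toFinset) : f.maxGenEigenspace μ ≠ ⊥ := by
  have hroot := (Polynomial.mem_roots (LinearMap.charpoly_monic f).ne_zero).1 (Multiset.mem_toFinset.1 hμ)
  have hev : f.HasEigenvalue μ := (Module.End.hasEigenvalue_iff_isRoot_charpoly f μ).2 hroot
  intro hbot
  apply hev
  exact eq_bot_iff.2 (((f.genEigenspace μ).monotone le_top).trans hbot.le)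

/-- `dim V = Σ_{μ root of χ_f} dim E_μ(f)`. [folklore] -/
private theorem finrank_eq_sum_maxGenEigenspace (f : Module.End ℂ V) :
    Module.finrank ℂ V = ∑ μ ∈ f.charpoly.roots.toFinset, Module.finrank ℂ (f.maxGenEigenspace μ) := by
  classical
  have hint : DirectSum.IsInternal fun μ : f.charpoly.roots.toFinset => f.maxGenEigenspace (μ : ℂ) := by
    refine DirectSum.isInternal_submodule_of_iSupIndep_of_iSup_eq_top ?_ ?_
    · exact (Module.End.independent_maxGenEigenspace f).comp Subtype.val_injective
    · refine top_unique ((Module.End.iSup_maxGenEigenspace_eq_top f).ge.trans (iSup_le fun μ => ?_))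
      by_cases hμ : μ ∈ f.charpoly.roots.toFinset
      · exact le_iSup (fun μ : f.charpoly.roots.toFinset => f.maxGenEigenspace (μ : ℂ)) ⟨μ, hμ⟩
      · rw [maxGenEigenspace_eq_bot_of_not_mem f hμ]
        exact bot_le
  have b := hint.collectedBasis fun μ => Module.finBasis ℂ (f.maxGenEigenspace (μ : ℂ))
  rw [Module.finrank_eq_card_basis b, Fintype.card_sigma]
  simp only [Fintype.card_fin]
  exact Finset.sum_coe_sort f.charpoly.roots.toFinset (fun μ => Module.finrank ℂ (f.maxGenEigenspace μ))

end Generic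

/-- **Orbit count**: a finite set of non-zero complex numbers stable under multiplication by a primitive
`p`-th root of unity `q`, weighted by a `q`-invariant weight, has total weight `p` times the weight of a
set of orbit representatives. [folklore] -/
private theorem orbit_sum {q : ℂ} {p : ℕ} (hp : 0 < p) (hprim : IsPrimitiveRoot q p) (m : ℂ → ℕ)
    (hm : ∀ z, m (q * z) = m z) : ∀ (n : ℕ) (R : Finset ℂ), R.card = n → (0 : ℂ) ∉ R →
    (∀ z ∈ R, q * z ∈ R) → ∃ R' : Finset ℂ, R' ⊆ R ∧ ∑ z ∈ R, m z = p * ∑ z ∈ R', m z := by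
  intro n
  induction n using Nat.strong_induction_on with
  | _ n ih =>
  intro R hRn h0 hinv
  rcases R.eq_empty_or_nonempty with rfl | ⟨z₀, hz₀⟩
  · exact ⟨∅, Finset.Subset.refl _, by simp⟩
  have hqp : q ^ p = 1 := hprim.pow_eq_one
  have hz₀0 : z₀ ≠ 0 := fun h => h0 (h ▸ hz₀)
  have hmk : ∀ k : ℕ, m (q ^ k * z₀) = m z₀ := by
    intro k
    induction k with
    | zero => rw [pow_zero, one_mul]
    | succ k ih' => rw [pow_succ', mul_assoc, hm, ih']
  have hRk : ∀ k : ℕ, q ^ k * z₀ ∈ R := by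
    intro k
    induction k with
    | zero => rwa [pow_zero, one_mul]
    | succ k ih' => rw [pow_succ', mul_assoc]; exact hinv _ ih'
  let O : Finset ℂ := (Finset.range p).image fun k => q ^ k * z₀
  have hOR : O ⊆ R := by
    intro z hz
    obtain ⟨k, -, rfl⟩ := Finset.mem_image.1 hz
    exact hRk k
  have hinj : Set.InjOn (fun k => q ^ k * z₀) (Finset.range p : Set ℕ) := by
    intro i hi j hj hij
    exact hprim.pow_inj (Finset.mem_range.1 (Finset.mem_coe.1 hi)) (Finset.mem_range.1 (Finset.mem_coe.1 hj))
      (mul_right_cancel₀ hz₀0 hij)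
  have hOcard : O.card = p := by
    rw [Finset.card_image_of_injOn hinj, Finset.card_range]
  have hOsum : ∑ z ∈ O, m z = p * m z₀ := by
    rw [Finset.sum_image hinj, Finset.sum_congr rfl fun k _ => hmk k, Finset.sum_const, Finset.card_range,
      smul_eq_mul]
  have hinv' : ∀ z ∈ R \ O, q * z ∈ R \ O := by
    intro z hz
    rw [Finset.mem_sdiff] at hz ⊢
    refine ⟨hinv z hz.1, fun hqz => hz.2 ?_⟩
    obtain ⟨k, -, hkz⟩ := Finset.mem_image.1 hqz
    refine Finset.mem_image.2 ⟨(k + (p - 1)) % p, Finset.mem_range.2 (Nat.mod_lt _ hp), ?_⟩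
    calc q ^ ((k + (p - 1)) % p) * z₀ = q ^ (p - 1) * (q ^ k * z₀) := by
          rw [pow_mod_eq_of_pow_eq_one hqp, pow_add]; ring
      _ = q ^ (p - 1) * (q * z) := by rw [hkz]
      _ = q ^ (p - 1 + 1) * z := by rw [pow_succ]; ring
      _ = z := by rw [Nat.sub_add_cancel hp, hqp, one_mul]
  have hcard' : (R \ O).card < n := by
    have := Finset.card_sdiff_add_card_eq_card hOR
    omega
  obtain ⟨R'', hR''sub, hR''sum⟩ :=
    ih _ hcard' (R \ O) rfl (fun h => h0 (Finset.mem_sdiff.1 h).1) hinv'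
  refine ⟨insert z₀ R'', ?_, ?_⟩
  · intro z hz
    rcases Finset.mem_insert.1 hz with rfl | hz
    · exact hz₀
    · exact (Finset.mem_sdiff.1 (hR''sub hz)).1
  · have hz₀R'' : z₀ ∉ R'' := fun h => (Finset.mem_sdiff.1 (hR''sub h)).2
      (Finset.mem_image.2 ⟨0, Finset.mem_range.2 hp, by rw [pow_zero, one_mul]⟩)
    rw [Finset.sum_insert hz₀R'', ← Finset.sum_sdiff hOR, hOsum, hR''sum]
    ring

/-- **Necessity in the canonical case**: an eater of the canonical table forces `A₀₁ A₂₃ = 0` in `ℤ/N`.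
Proof: `Γ₂, Γ₃` preserve every generalized eigenspace `E_λ` of `Γ₀` and satisfy `Γ₂Γ₃ = ω^b Γ₃Γ₂` there, so
`ω^{b·dim E_λ} = 1`; `Γ₁` maps `E_λ ↪ E_{ω^a λ}`, so `dim E_λ` is constant on `ω^a`-orbits, which have
size `p₁ = N/gcd(a,N)`; hence `N = p₁ M` with `N ∣ b M`, i.e. `N ∣ a b`. [cite: Gonzalezarroyo1998, §4.2] -/
private theorem mul_eq_zero_of_eaterRel_canon [NeZero N] {B : Matrix (Fin 4) (Fin 4) (ZMod N)} (hc : IsCanon B)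
    {Γ : Fin 4 → SUN N} (h : EaterRel B Γ) : B 0 1 * B 2 3 = 0 := by
  classical
  set a := B 0 1 with ha
  set b := B 2 3 with hb
  let u : Fin 4 → Module.End ℂ (Fin N → ℂ) := fun μ => Matrix.toLin' (Γ μ : Matrix (Fin N) (Fin N) ℂ)
  have hrel : ∀ μ ν, u μ * u ν = centerPhase N (B μ ν) • (u ν * u μ) := fun μ ν => toLin'_rel (h μ ν)
  have hinj : ∀ μ, Function.Injective (u μ) := fun μ => toLin'_injective (Γ μ)
  have h01 := hrel 0 1
  have h02 := hrel 0 2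
  have h03 := hrel 0 3
  have h23 := hrel 2 3
  rw [hc.1, centerPhase_zero] at h02
  rw [hc.2.1, centerPhase_zero] at h03
  have hNpos : 0 < N := Nat.pos_of_ne_zero (NeZero.ne N)
  -- dimensions of the generalized eigenspaces of `Γ₀`
  set m : ℂ → ℕ := fun μ => Module.finrank ℂ ((u 0).maxGenEigenspace μ) with hm
  have hbm : ∀ μ, N ∣ b.val * m μ := fun μ => by
    rw [← centerPhase_pow_eq_one_iff]
    exact phase_pow_finrank_eq_one h02 h03 h23 (hinj 2) (hinj 3) μ
  have ham : ∀ μ, m (centerPhase N a * μ) = m μ := fun μ =>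
    finrank_maxGenEigenspace_eq_of_rel h01 (hinj 1) hNpos (centerPhase_pow N a) μ
  set R := (u 0).charpoly.roots.toFinset with hR
  have hsum : N = ∑ μ ∈ R, m μ := by
    rw [← finrank_eq_sum_maxGenEigenspace (u 0)]
    exact (Module.finrank_fin_fun ℂ).symm
  have hmem : ∀ μ, μ ∈ R ↔ m μ ≠ 0 := by
    intro μ
    constructor
    · intro hμ hm0
      exact maxGenEigenspace_ne_bot_of_mem (u 0) hμ (Submodule.finrank_eq_zero.1 hm0)
    · intro hm0
      by_contra hμ
      exact hm0 (Submodule.finrank_eq_zero.2 (maxGenEigenspace_eq_bot_of_not_mem (u 0) hμ))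
  have hinv : ∀ μ ∈ R, centerPhase N a * μ ∈ R := fun μ hμ => by
    rw [hmem] at hμ ⊢; rwa [ham]
  have h0 : (0 : ℂ) ∉ R := by
    rw [hmem, not_not]
    apply Submodule.finrank_eq_zero.2
    rw [Submodule.eq_bot_iff]
    intro x hx
    rw [Module.End.mem_maxGenEigenspace] at hx
    obtain ⟨k, hk⟩ := hx
    rw [zero_smul, sub_zero, Module.End.pow_apply] at hk
    exact (hinj 0).iterate k (by rw [hk]; exact (Function.iterate_fixed (map_zero (u 0)) k).symm)
  -- `ω^a` is a primitive `p₁`-th root of unity, `p₁ = N / gcd(a,N)`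
  set g₁ := Nat.gcd a.val N with hg₁
  have hg₁N : g₁ ∣ N := Nat.gcd_dvd_right _ _
  have hg₁a : g₁ ∣ a.val := Nat.gcd_dvd_left _ _
  have hg₁0 : 0 < g₁ := Nat.gcd_pos_of_pos_right _ hNpos
  set p₁ := N / g₁ with hp₁
  have hp₁N : p₁ * g₁ = N := Nat.div_mul_cancel hg₁N
  have hp₁0 : 0 < p₁ := Nat.pos_of_ne_zero (fun h => by rw [h, zero_mul] at hp₁N; omega)
  have hprim : IsPrimitiveRoot (centerPhase N a) p₁ := by
    rw [centerPhase_eq_pow]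
    have h1 : IsPrimitiveRoot (rootω N ^ g₁) p₁ :=
      (rootω_isPrimitiveRoot N).pow hNpos (by rw [mul_comm]; exact hp₁N.symm)
    have h2 := h1.pow_of_coprime (a.val / g₁) (by
      have := Nat.coprime_div_gcd_div_gcd (m := a.val) (n := N) hg₁0
      exact this)
    rwa [← pow_mul, Nat.mul_div_cancel' hg₁a] at h2
  obtain ⟨R', -, hR'sum⟩ := orbit_sum hp₁0 hprim m ham R.card R rfl h0 hinv
  -- `N = p₁ M`, `N ∣ b M`
  have hM : N ∣ b.val * ∑ μ ∈ R', m μ := by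
    rw [Finset.mul_sum]
    exact Finset.dvd_sum fun μ _ => hbm μ
  have hMg : ∑ μ ∈ R', m μ = g₁ := by
    have : p₁ * ∑ μ ∈ R', m μ = p₁ * g₁ := by rw [← hR'sum, ← hsum, hp₁N]
    exact Nat.eq_of_mul_eq_mul_left hp₁0 this
  rw [hMg] at hM
  have hab : N ∣ a.val * b.val := by
    obtain ⟨t, ht⟩ := hg₁a
    have : a.val * b.val = (b.val * g₁) * t := by rw [ht]; ring
    rw [this]
    exact dvd_mul_of_dvd_left hM t
  apply (ZMod.val_eq_zero _).1
  rw [ZMod.val_mul]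
  exact Nat.mod_eq_zero_of_dvd hab


end Necessity

/-! ### Assembly -/

section Assembly

variable {N : ℕ} [NeZero N]

/-- The canonical case: eaters exist iff `A₀₁ A₂₃ = 0` in `ℤ/N` (i.e. `p₁ p₂ ∣ N`). [cite: Gonzalezarroyo1998, §4.2] -/
private theorem exists_eaterRel_iff_of_canon {B : Matrix (Fin 4) (Fin 4) (ZMod N)} (hB : IsAlt B) (hc : IsCanon B) :
    (∃ Γ : Fin 4 → SUN N, EaterRel B Γ) ↔ pf B = 0 := by
  have hpf : pf B = B 0 1 * B 2 3 := by
    rw [pf, hc.1, hc.2.1, hc.2.2.1, hc.2.2.2]; ring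
  rw [hpf]
  exact ⟨fun ⟨Γ, hΓ⟩ => mul_eq_zero_of_eaterRel_canon hc hΓ, fun h => exists_eaterRel_of_canon hB hc h⟩

/-- Eaters of an alternating table exist iff its Pfaffian vanishes in `ℤ/N`. [cite: Gonzalezarroyo1998, §4.2] -/
theorem exists_eaterRel_iff_pf_eq_zero {A : Matrix (Fin 4) (Fin 4) (ZMod N)} (hA : IsAlt A) :
    (∃ Γ : Fin 4 → SUN N, EaterRel A Γ) ↔ pf A = 0 := by
  obtain ⟨B, hBc, hBalt, he, hp⟩ := canonReach A hA
  rw [he, hp]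
  exact exists_eaterRel_iff_of_canon hBalt hBc

end Assembly

/-- **DISCHARGE of the named fact `EaterIffOrthogonal`** (González-Arroyo 1998 §4.2, after 't Hooft 1981,
van Baal 1983, van Baal–van Geemen 1986, Lebedev–Polikarpov 1986): for `SU(N)` on `T⁴` a twist tensor admits
twist eaters iff the twist is orthogonal, `κ(n) = n₀₁n₂₃ − n₀₂n₁₃ + n₀₃n₁₂ = 0` in `ℤ/N`.
[cite: Gonzalezarroyo1998, §4.2] -/
theorem EaterIffOrthogonal_holds : ∀ (N : ℕ) [NeZero N], EaterIffOrthogonal N := by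
  intro N _ n
  rw [← pf_altOfTensor n, ← exists_eaterRel_iff_pf_eq_zero (isAlt_altOfTensor n)]
  exact exists_congr fun Γ => isTwistEater_iff_eaterRel n Γ


/-! ### Consequences for every `SU(N)` twist sector on `L⁴` ('t Hooft's dichotomy, classical limit) -/

section Dichotomy

open Literature.MathematicalPhysics.QuantumFieldTheory (GaugeConfig)

variable {N : ℕ} [NeZero N]

/-- **NO-FLAT for every non-orthogonal `SU(N)` twist, every `L ≥ 1`** (González-Arroyo 1998 §8.1: «zero action solutions
can only occur for orthogonal twists»): if `κ(n) ≠ 0` in `ℤ/N` then no configuration on `(ℤ/L)⁴` has zero twisted Wilson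
action — zero action ⇒ twisted-flat ⇒ a twist eater exists ⇒ `κ(n) = 0` by `EaterIffOrthogonal_holds`. (The `SU(2)`,
`κ = 1` case is the tree's `noZeroActionHooft`.) [cite: Gonzalezarroyo1998, §8.1] -/
theorem twistedWilsonAction_ne_zero_of_twistKappa_ne_zero {n : Plane 4 → ZMod N} (hn : twistKappa n ≠ 0) {L : ℕ}
    [NeZero L] (U : GaugeConfig 4 L (SUN N)) :
    twistedWilsonAction (fundamentalRep (Fin N)) (twistOfTensor N n) U ≠ 0 := by
  intro hU
  obtain ⟨Γ, hΓ⟩ := exists_isTwistEater_of_isTwistedFlat (isTwistedFlat_of_twistedWilsonAction_eq_zero hU)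
  exact hn ((EaterIffOrthogonal_holds N n).1 ⟨Γ, hΓ⟩)

/-- **Positive classical action of a non-orthogonal sector**: `κ(n) ≠ 0 ⇒ S_cl(n; L) > 0` on every `L⁴`.
[cite: Gonzalezarroyo1998, §8.1] -/
theorem minTwistAction_pos_of_twistKappa_ne_zero {n : Plane 4 → ZMod N} (hn : twistKappa n ≠ 0) (L : ℕ) [NeZero L] :
    0 < minTwistAction (fundamentalRep (Fin N)) (twistOfTensor N n) L :=
  minTwistAction_pos_of_ne_zero (fundamentalRep (Fin N)) (continuous_fundamentalRep (Fin N))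
    (twistedWilsonAction_ne_zero_of_twistKappa_ne_zero hn)

/-- **Zero classical action of an orthogonal sector**: `κ(n) = 0 ⇒ S_cl(n; L) = 0` (a twist eater exists and eats the
twist). [cite: Gonzalezarroyo1998, §8.1] -/
theorem minTwistAction_eq_zero_of_twistKappa_eq_zero {n : Plane 4 → ZMod N} (hn : twistKappa n = 0) (L : ℕ) [NeZero L] :
    minTwistAction (fundamentalRep (Fin N)) (twistOfTensor N n) L = 0 := by
  obtain ⟨Γ, hΓ⟩ := (EaterIffOrthogonal_holds N n).2 hn
  exact minTwistAction_eq_zero_of_isTwistEater (fundamentalRep (Fin N)) (continuous_fundamentalRep (Fin N)) hΓ L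

/-- **'t Hooft's dichotomy for `SU(N)` on the lattice 4-torus, weak-coupling classical limit at FIXED volume**
(t Hooft 1979 §4–§5; González-Arroyo 1998 §8.1–8.2): the twist free energy `−β⁻¹ log (Z_n(β)/Z(β))` of the sector with
twist tensor `n` tends, as `β → ∞`, to `S_cl(n; L)`, which is `> 0` iff the twist is NON-orthogonal (`κ(n) ≠ 0`) and `= 0`
iff it is orthogonal. «NOT THE CLAY GAP»: `β → ∞` at fixed cut-off volume, nothing uniform in `L`.
[cite: tHooft1979Flux, §4–§5] [cite: Gonzalezarroyo1998, §8.1] -/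
theorem twistFreeEnergy_rate_pos_iff {n : Plane 4 → ZMod N} (L : ℕ) [NeZero L] :
    (∃ S : ℝ, 0 < S ∧ Filter.Tendsto (fun β : ℝ => -β⁻¹ * Real.log
      (twistZ (fundamentalRep (Fin N)) (twistOfTensor N n) β L /
        twistZ (fundamentalRep (Fin N)) (1 : Twist 4 (SUN N)) β L)) Filter.atTop (nhds S)) ↔ twistKappa n ≠ 0 := by
  have hrate := twistFreeEnergy_rate (fundamentalRep (Fin N)) (continuous_fundamentalRep (Fin N)) (twistOfTensor N n) L
  constructor
  · rintro ⟨S, hS, hT⟩ hn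
    have := tendsto_nhds_unique hT hrate
    rw [minTwistAction_eq_zero_of_twistKappa_eq_zero hn L] at this
    exact hS.ne' this
  · intro hn
    exact ⟨_, minTwistAction_pos_of_twistKappa_ne_zero hn L, hrate⟩

end Dichotomy

end TwistedSector

end Literature.MathematicalPhysics.QuantumLattice
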